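import Literature.NumberTheory.EllipticCurves.Kato2004.DivisibilityInputsFine
import HarnessLib

/-!
# Kato 2004 (Astérisque 295) Thm. 12.6 with Ex. 13.3 and §13.8: the zeta submodule `Z ⊂ 𝐇¹` is spanned
# by Λ-adic classes of GENUINE integral Euler systems — the predicate `IsEulerSystemClass` and ONE
# construction fact (`exists_divisibilityInputs_fineQuotient_zeta` = `exists_divisibilityInputs_fineQuotient`
# + the span clause)

Topic `NumberTheory/EllipticCurves`, sub-directory `Kato2004` (namespace = path).  Cell `bsd-smallim`
(rung K6 of `BirchSwinnertonDyer`, class X9, route `SmallImageMuTransfer`, crux `MuTransferX9` = item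
19276), seat `bsd-smallim-k6-c2` (gen 2).  Statements first; no instance, no notation; nothing asserted.

WHY (honest framing).  In the §17.13 package `K : Kato2004.DivisibilityInputs W p f κ γ I D` the zeta
submodule `K.Z : Submodule Λ I.H` is a bare FIELD: its docstring says "the `Λ`-span of the integral zeta
elements (8.1.3)/(8.11)", but no field ties it to classes of an Euler system.  The cell's `μ`-transfer
(HOME/koly/MU-TRANSFER-PROOF.md) needs, after §6 (i) ("`μ(L_p) = 0 ⟹ ∃ z ∈ Z, z ∉ p𝐇¹`", tree
`Kato2004.exists_mem_zeta_not_mem_of_mu_eq_zero`), to run an Euler-system argument WITH THAT CLASS: its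
tame companions `z_{qp^n}` and their norm relations (13.1.1).  So the hypothesis of the cell's Theorem A
must be about a GENUINE class, and the package must record Kato's Thm. 12.6 as printed: "Let `Z` be the
`Λ`-submodule of `𝐇¹(V_{O_λ}(f))` generated by the following elements (1) `(_{c,d}z^{(p)}_{p^n}(f, k, j,
a(A), prime(pA)))_{n≥1}` … (2) `(_{c,d}z^{(p)}_{p^n}(f, k, j, α, prime(pN)))_{n≥1}` …" [p. 222], each of
which is the `p`-power line of the Euler system `(z_m)_{m ∈ Ξ}` of Ex. 13.3 [p. 225] ("Then `(z_m)_m` is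
an Euler system for `(T, F_λ, Σ)`"), integral by (8.1.3) [p. 180] (`z_m ∈ H¹(ℤ[ζ_m, 1/p], T)`).

* `coresToLayer W p κ hU n h` — the corestriction `H¹(U, T_pW) → H¹(ℚ_n, T_pW)` to the `n`-th layer of
  `κ` from an open subgroup `U ≤ Gal(ℚ̄/ℚ_n)` (packaging of the tree's `coresLe`, exactly as
  `Kato2004.layerCores`); for `U = Gal(ℚ̄/ℚ(μ_{p^{n+1}}))` and the cyclotomic `κ` this is the trace
  `H¹(ℚ(ζ_{p^{n+1}}), T) → H¹(ℚ_n, T)` of §13.8 [p. 228] by which the `Δ`-trivial component of `𝐇¹(T)`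
  (= the tree's pinned `𝐇¹_Γ(T_pW)`, `IwasawaH1Data`, module docstring READING of
  `IwasawaCohomology.lean`: "`𝐇¹_Γ(T) = 𝐇¹(T)^Δ = e₀·𝐇¹(T)`", `cor ∘ res = p − 1` a unit) is reached.
* `IsEulerSystemClass W p κ γ I s` — `s ∈ 𝐇¹_Γ(T_pW)` is, layer by layer, the trace to `ℚ_n` of the
  level-`ℚ(μ_{p^{n+1}})` class of an INTEGRAL Euler system `z` for `T_pW` over the cyclotomic levels
  away from a finite bad set `S` (tree `IsEulerSystem (cyclotomicLevelsRat p S) (tateRep W p) p z`,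
  Rubin Def. 2.1.1 = Kato (13.1.1) in the form `ZetaBody` (C1) uses; integrality = `integralH1`,
  §8.2/Lemma 8.5 = `ZetaBody` (C2)).  Kato's systems (1)(2) above are such; so is any `Λ`-multiple-free
  relabelling — the predicate only records what an Euler-system ARGUMENT consumes.
* `exists_divisibilityInputs_fineQuotient_zeta` — ONE construction fact: the §17.13 package exists
  TOGETHER WITH the fine quotient `π : X ↠ X₀` of (14.9.3)/(17.13.1) (verbatim the tree's
  `Kato2004.exists_divisibilityInputs_fineQuotient`, file `DivisibilityInputsFine`) AND with
  `K.Z ≤ span {s | IsEulerSystemClass W p κ γ I s}` (Thm. 12.6 as printed, projected to the `Δ`-trivial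
  component: `e₀·(z_{p^{n+1}})_n ↔ (p−1)⁻¹·(Cor z_{p^{n+1}})_n`).  Weaker than print (identity of
  `P, 𝐇², π` forgotten; `Z` only bounded above by the span), never stronger.
* `exists_isEulerSystemClass_not_mem` (PROVED): under the span clause, "`∃ z ∈ K.Z, z ∉ p𝐇¹`" gives a
  GENUINE Euler-system class `s ∉ p𝐇¹` — the form in which the cell's Theorem A (crux `MuTransferX9`,
  registered skeleton v2 sha16 cdf296cec74a80c3, stub `stub_theoremA_fine`) consumes §6 (i).

This is the file asked for by the definition item `defn-Kato2004.EulerSystemClasses` (planner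
`bsd-smallim-plan` g5, RULING 2026-08-26T05:58Z, T1): the skeleton-v2-local declarations VERBATIM
(`coresToLayer`, `IsEulerSystemClass`, `exists_divisibilityInputs_fineQuotient_zeta`); the fourth,
`nonempty_fineSelmerDualData`, is NOT restated here because it is meanwhile a THEOREM of the tree
(`WeierstrassCurve.nonempty_fineSelmerDualData`, file `KatoFineSelmerDualProofs`, cell `bsd-potss`).

References: K. Kato, Astérisque 295 (2004): (8.1.3) p. 180, §8.2/Lemma 8.5 pp. 180–184, §12.2 p. 220,
Thm. 12.6 p. 222, §13.1 (13.1.1) and Ex. 13.3 pp. 224–225, §13.8 p. 228, (14.9.3) p. 240, §17.13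
pp. 279–280 [Kato2004Asterisque]; K. Rubin, *Euler Systems* (2000), Def. 2.1.1, Remark 2.1.4 [Rubin2000];
tree `Kato2004/{EulerSystemValues, IwasawaCohomology, DivisibilityInputs, DivisibilityInputsFine}.lean`.
-/

noncomputable section

open scoped NumberField
open Field IsDedekindDomain CongruenceSubgroup
open Literature.NumberTheory.GaloisRepresentations
open Literature.NumberTheory.EllipticCurves Literature.NumberTheory.EllipticCurves.ModularForms
open Literature.NumberTheory.EllipticCurves.Kato2004.EulerSystemValues

namespace Literature.NumberTheory.EllipticCurves.Kato2004

/-! ## The trace to a layer and the predicate "genuine Λ-adic Euler-system class" -/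

section Vocabulary

variable (W : WeierstrassCurve ℚ) [W.IsElliptic] (p : ℕ) [Fact p.Prime]
  [ContinuousSMul ℤ_[p] (W.tateModule p)] (κ : ZpExtension ℚ p) (γ : absoluteGaloisGroup ℚ)

/-- The corestriction `Cor : H¹(U, T_pW) → H¹(ℚ_n, T_pW)` from an open subgroup `U` of `Γ_ℚ`
contained in `Gal(ℚ̄/ℚ_n) = κ.layerSubgroup n` (the inclusion `h` is an argument; for the cyclotomic
`κ` and `U = Gal(ℚ̄/ℚ(μ_{p^{n+1}}))` it holds since `ℚ_n ⊂ ℚ(μ_{p^{n+1}})`), packaged from the tree's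
relative corestriction `coresLe` exactly as `Kato2004.layerCores`.  Kato §13.8 [p. 228]: the trace
`H¹(ℚ(ζ_{p^{n+1}}), T) → H¹(ℚ_n, T)` onto the `Δ`-trivial component.
[cite: Kato2004Asterisque, §12.2 (p. 220) and §13.8 (p. 228)] -/
def coresToLayer {U : Subgroup (absoluteGaloisGroup ℚ)} (hU : IsOpen (U : Set (absoluteGaloisGroup ℚ)))
    (n : ℕ) (h : U ≤ κ.layerSubgroup n) :
    H1 (tateRep W p) U →ₗ[ℤ_[p]] H1 (tateRep W p) (κ.layerSubgroup n) :=
  haveI : U.FiniteIndex := finiteIndex_of_isOpen_of_compactSpace _ hU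
  haveI : Fintype (κ.layerSubgroup n ⧸ U.subgroupOf (κ.layerSubgroup n)) := Fintype.ofFinite _
  coresLe (tateRep W p).toTopRep h hU

variable [Module.Free ℤ_[p] (W.tateModule p)] [Module.Finite ℤ_[p] (W.tateModule p)]

/-- **`s ∈ 𝐇¹_Γ(T_pW)` is the Λ-adic class of a GENUINE integral Euler system for `T_pW`.**  There are
a FINITE set `S` of bad places, an Euler system `z = (z_{k,r})` for `T_pW` over the cyclotomic levels
`ℚ(μ_{p^k})·∏_{q∈r}ℚ(μ_q)` away from `S` (Rubin Def. 2.1.1 = tree `IsEulerSystem`; Kato (13.1.1),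
Ex. 13.3: "`(z_m)_m` is an Euler system for `(T, F_λ, Σ)`", `Σ = prime(cdpAN)` resp. `prime(cdpN)`),
all of whose classes are integral (tree `integralH1`: unramified away from `p` at class level — Kato
§8.2/Lemma 8.5, (8.1.3): "`z_m ∈ H¹(ℤ[ζ_m, 1/p], T)`"), and inclusions `Gal(ℚ̄/ℚ(μ_{p^{n+1}})) ≤
Gal(ℚ̄/ℚ_n)`, such that for every `n` the `n`-th layer component of `s` is the trace to `ℚ_n` of the
level-`ℚ(μ_{p^{n+1}})` class `z_{n+1,∅}` (Kato §13.8, p. 228; Thm. 13.4 "`Z` … generated by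
`(z_{p^n})_n`").  Kato's systems `(_{c,d}z^{(p)}_m(f, 2, 1, ξ, ·))_m` of Thm. 12.6 (1) (`ξ = a(A)`) and
(2) (`ξ = α ∈ SL₂(ℤ)`) are such by Ex. 13.3 (for (1): tree `Kato2004.ZetaBody` (C1)(C2)).
[cite: Kato2004Asterisque, §13.1 (13.1.1), Ex. 13.3 (pp. 224–225), Thm. 13.4 (p. 226), (8.1.3), §8.2 and Lemma 8.5 (pp. 180–184), §13.8 (p. 228)]
[cite: Rubin2000, Def. 2.1.1 and Remark 2.1.4] -/
def IsEulerSystemClass (I : IwasawaH1Data W p κ γ) (s : I.H) : Prop :=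
  ∃ (S : Set (HeightOneSpectrum (𝓞 ℚ))) (_ : S.Finite)
    (z : ∀ (k : ℕ) (r : (cyclotomicLevelsRat p S).Ideals),
      H1 (tateRep W p) ((cyclotomicLevelsRat p S).level k r.1)),
    IsEulerSystem (cyclotomicLevelsRat p S) (tateRep W p) p z ∧
    (∀ (k : ℕ) (r : (cyclotomicLevelsRat p S).Ideals),
      z k r ∈ integralH1 (tateRep W p) p ((cyclotomicLevelsRat p S).level k r.1)) ∧
    ∃ h : ∀ n : ℕ, (cyclotomicLevelsRat p S).level (n + 1) ∅ ≤ κ.layerSubgroup n,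
      ∀ n : ℕ, I.proj n s =
        coresToLayer W p κ ((cyclotomicLevelsRat p S).isOpen_level (n + 1) ∅) n (h n)
          (z (n + 1) (cyclotomicLevelsRat p S).idealOne)

end Vocabulary

/-! ## The construction fact: the §17.13 package with the fine quotient AND the Thm. 12.6 span clause -/

/-- **Kato 2004, Thm. 12.6 (p. 222) with Ex. 13.3 (p. 225), (14.9.3) (p. 240) and (17.13.1) (p. 279):
the §17.13 package EXISTS on the pinned pair `(𝐇¹_Γ(T_pW), X(E/ℚ_∞))` together with (i) a SURJECTIVE
fine quotient `π : X(E/ℚ_∞) ↠ X₀(E/ℚ_∞)` exact after `P → X` — verbatim the tree's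
`Kato2004.exists_divisibilityInputs_fineQuotient` (file `DivisibilityInputsFine`, whose docstring carries
the printed content of (14.9.3)/(17.13.1) and Kim AJM 148 §1.2.4) — and (ii) the zeta submodule `K.Z`
contained in the `Λ`-span of GENUINE Λ-adic Euler-system classes (`IsEulerSystemClass`): Thm. 12.6 "Let
`Z` be the `Λ`-submodule of `𝐇¹(V_{O_λ}(f))` generated by the following elements (1)
`(_{c,d}z^{(p)}_{p^n}(f, k, j, a(A), prime(pA)))_{n≥1} ∈ 𝐇¹(T)` (`1 ≤ j ≤ k−1`, `a, A ∈ ℤ`, `A ≥ 1`,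
`c, d ∈ ℤ`, `(c, 6pA) = (d, 6pN) = 1`) (2) `(_{c,d}z^{(p)}_{p^n}(f, k, j, α, prime(pN)))_{n≥1} ∈ 𝐇¹(T)`
(`α ∈ SL₂(ℤ)`, `(cd, 6pN) = 1`, `c ≡ d ≡ 1 mod N`)", each generator being the `p`-power line of the
Euler system of Ex. 13.3, projected to the `Δ`-trivial component (`e₀·(z_{p^{n+1}})_n` corresponds to
`(p−1)⁻¹·(Cor_{ℚ(ζ_{p^{n+1}})/ℚ_n} z_{p^{n+1}})_n` under the pin of `IwasawaH1Data`; `p − 1 ∈ ℤ_pˣ`).**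
Binders: every elliptic curve `E/ℚ` with globally minimal model `W` (structure facts of `T_pW` as
instance BINDERS, convention of `EulerSystemValues.tateRep`), every ODD good ordinary prime `p`, the
cyclotomic `κ` with topological generator `γ` matching the cyclotomic variable, every newform `f` of
`W`, every `I`, `D`, `Y`.  A CONSTRUCTION fact (weaker than print: `P, 𝐇², 𝐇²_loc, π` forgotten up to
the listed properties; `Z` only bounded above by the span; the `a(A)`-type systems alone would need the
unprinted finiteness of `Z(f,T)/Z_{a(A)}`, so BOTH printed families are allowed by the predicate),
never stronger; nothing asserted; no `_holds` expected soon.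
[cite: Kato2004Asterisque, Thm. 12.6 (p. 222), Ex. 13.3 (p. 225), (14.9.3) (p. 240), §17.13 (17.13.1) (p. 279) and p. 280] -/
def exists_divisibilityInputs_fineQuotient_zeta : Prop :=
  ∀ (W : WeierstrassCurve ℚ) [W.IsElliptic] [W.IsGloballyMinimal] (p : ℕ) [Fact p.Prime]
    [ContinuousSMul ℤ_[p] (W.tateModule p)] [Module.Free ℤ_[p] (W.tateModule p)]
    [Module.Finite ℤ_[p] (W.tateModule p)] {N : ℕ} [NeZero N] (f : CuspForm (Gamma0 N) 2)
    (κ : ZpExtension ℚ p) (γ : absoluteGaloisGroup ℚ),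
    p ≠ 2 → IsOrdinaryAt W p → κ.IsCyclotomic → κ.IsTopGenerator γ → IsCyclotomicVariable p γ →
    IsNewformOf W f →
    ∀ (I : IwasawaH1Data W p κ γ) (D : W.SelmerDualData κ γ) (Y : W.FineSelmerDualData κ γ),
      ∃ (K : DivisibilityInputs W p f κ γ I D) (π : D.X →ₗ[IwasawaAlgebra p] Y.X),
        Function.Surjective π ∧ Function.Exact K.toX π ∧
        K.Z ≤ Submodule.span (IwasawaAlgebra p) {s : I.H | IsEulerSystemClass W p κ γ I s}

/-- The span-clause fact implies the tree's `exists_divisibilityInputs_fineQuotient` (it only adds a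
conjunct). [cite: Kato2004Asterisque, (14.9.3) (p. 240) and §17.13 (p. 279)] -/
theorem exists_divisibilityInputs_fineQuotient_of_zeta (h : exists_divisibilityInputs_fineQuotient_zeta) :
    ∀ (W : WeierstrassCurve ℚ) [W.IsElliptic] [W.IsGloballyMinimal] (p : ℕ) [Fact p.Prime]
      [ContinuousSMul ℤ_[p] (W.tateModule p)] [Module.Free ℤ_[p] (W.tateModule p)]
      [Module.Finite ℤ_[p] (W.tateModule p)] {N : ℕ} [NeZero N] (f : CuspForm (Gamma0 N) 2)
      (κ : ZpExtension ℚ p) (γ : absoluteGaloisGroup ℚ),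
      p ≠ 2 → IsOrdinaryAt W p → κ.IsCyclotomic → κ.IsTopGenerator γ → IsCyclotomicVariable p γ →
      IsNewformOf W f →
      ∀ (I : IwasawaH1Data W p κ γ) (D : W.SelmerDualData κ γ) (Y : W.FineSelmerDualData κ γ),
        ∃ (K : DivisibilityInputs W p f κ γ I D) (π : D.X →ₗ[IwasawaAlgebra p] Y.X),
          Function.Surjective π ∧ Function.Exact K.toX π := by
  intro W _ _ p _ _ _ _ N _ f κ γ hp hord hκ hγ hγ' hf I D Y
  obtain ⟨K, π, hπs, hπ, -⟩ := h W p f κ γ hp hord hκ hγ hγ' hf I D Y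
  exact ⟨K, π, hπs, hπ⟩

/-! ## §6 (i) of the cell's μ-transfer in GENUINE-class form (proved) -/

/-- If a submodule `Z` lies in the span of a set `S` and some `z ∈ Z` is not in the submodule `N`, then
some element of `S` is not in `N`. [cite: Kato2004Asterisque, Thm. 12.6 (p. 222)] -/
theorem exists_mem_not_mem_of_le_span {R M : Type*} [CommRing R] [AddCommGroup M] [Module R M]
    {Z N : Submodule R M} {S : Set M} (hZ : Z ≤ Submodule.span R S) {z : M} (hz : z ∈ Z)
    (hzN : z ∉ N) : ∃ s ∈ S, s ∉ N := by
  by_contra h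
  push Not at h
  exact hzN ((hZ.trans (Submodule.span_le.mpr h)) hz)

/-- **§6 (i) with Thm. 12.6: `μ(L_p(E)) = 0 ⟹` some GENUINE Λ-adic Euler-system class is not divisible
by `p` in `𝐇¹_Γ(T_pW)`.**  For a package `K` satisfying the span clause, `E[p]` irreducible and
`ι G₁ = L_p(E,T)` with `G₁ ∉ (p)`: `exists_mem_zeta_not_mem_of_mu_eq_zero` gives `z ∈ K.Z ∖ p𝐇¹`, and
some generator in the span is then `∉ p𝐇¹`. [cite: Kato2004Asterisque, Thm. 12.6 (p. 222) and §17.13 (p. 280)] -/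
theorem exists_isEulerSystemClass_not_mem {p : ℕ} [Fact p.Prime] {W : WeierstrassCurve ℚ}
    [W.IsElliptic] [W.IsGloballyMinimal] [ContinuousSMul ℤ_[p] (W.tateModule p)]
    [Module.Free ℤ_[p] (W.tateModule p)] [Module.Finite ℤ_[p] (W.tateModule p)] {N : ℕ} [NeZero N]
    {f : CuspForm (Gamma0 N) 2} {κ : ZpExtension ℚ p} {γ : absoluteGaloisGroup ℚ}
    {I : IwasawaH1Data W p κ γ} {D : W.SelmerDualData κ γ} (K : DivisibilityInputs W p f κ γ I D)
    (hZ : K.Z ≤ Submodule.span (IwasawaAlgebra p) {s : I.H | IsEulerSystemClass W p κ γ I s})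
    (hirr : W.HasIrreducibleModPGaloisRep p) {G₁ : IwasawaAlgebra p}
    (hG₁ : iwasawaToPowerSeries p G₁ = padicLFunction f (unitRoot W p : ℚ_[p]))
    (hμ : G₁ ∉ IwasawaAlgebra.augIdealP p) :
    ∃ s : I.H, IsEulerSystemClass W p κ γ I s ∧
      s ∉ IwasawaAlgebra.augIdealP p • (⊤ : Submodule (IwasawaAlgebra p) I.H) := by
  obtain ⟨z, hz, hzp⟩ := exists_mem_zeta_not_mem_of_mu_eq_zero K hirr hG₁ hμ
  obtain ⟨s, hs, hsp⟩ := exists_mem_not_mem_of_le_span hZ hz hzp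
  exact ⟨s, hs, hsp⟩

end Literature.NumberTheory.EllipticCurves.Kato2004

end
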